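import Literature.Geometry.Lorentzian.KerrRadiusPseudoconvexityKS
import HarnessLib

/-!
# Carter's constant of a null vector in Kerr–Schild coordinates: non-negativity and the polar bound

(family `gr`; namespace `Literature.Geometry.Lorentzian.Kerr`; all results proved; sequel to
`KerrRadiusPseudoconvexity.lean`, `KerrRadiusHessianIdentity.lean`, `KerrRadiusPseudoconvexityKS.lean`.)

For the Kerr metric `g = η + 2Hℓ ⊗ ℓ` in ingoing Kerr–Schild Cartesian coordinates (`Kerr.bilin`),
at a point `z` with `r > 0` and for a vector `w` write `E = Kerr.ksEnergy M a z w`,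
`L = Kerr.ksAngMom M a z w` (the Killing energies), `ℙ = E(r² + a²) − aL`, `ρ = dr_z(w)`,
`Σ = Kerr.blSigma a z⃗`, `Δ = r² − 2Mr + a²` and `s² = 1 − (z₃/r)² = sin²θ`. Carter's separated
equations for a NULL geodesic with velocity `w` read `Σ² ṙ² = ℙ² − Δ 𝒦` and
`Σ² θ̇² = 𝒦 − (L − aE sin²θ)²/sin²θ` with `𝒦 = 𝒬 + (L − aE)² ≥ 0` Carter's constant
(Carter 1968, §4; O'Neill 1995, Ch. 4, Thm. 4.2.2). Off the horizons the first one DEFINES `𝒦` from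
Kerr–Schild data, `𝒦 = (ℙ² − Σ²ρ²)/Δ` (`Kerr.ksCarterK`, a smooth function of `(z, w)`, axis
included); this file proves the two pointwise SIGN facts that the separated equations encode, as
polynomial inequalities valid at every point with `r > 0` and for every vector:

* `radial_inequality` — `(Σ²ρ² − ΣΔ g(w,w) − ℙ²) · Δ ≤ 0`; for a null `w` off the horizons:
  `𝒦 ≥ 0` (`ksCarterK_nonneg`);
* `polar_inequality` — `(s²(Σ²ρ² − ΣΔ g(w,w) − ℙ²) + Δ(L − a s² E)²) · Δ ≤ 0`; for a null `w` off
  the horizons: `(L − a s² E)² ≤ s² 𝒦` (`sq_sub_le_sinSq_mul_ksCarterK`).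

Both are read off Carter's identity `Σ²(wʳ)² − R(r; E, L, 𝒬) = ΣΔ g(w, w)` in the ingoing chart
(`Kerr.Ingoing.sq_sigma_mul_sq_sub_nullRadialPotential`), where `𝒦 = Σ²(w^μ)²/s² + (L − as²E)²/s²`
(`Kerr.Ingoing.carterQ_add_sq`), at the off-axis points, and extended across the rotation axis by
continuity (`Kerr.nonpos_region_of_offAxis`). They drive the incompleteness of the null geodesics of
the Kerr black-hole region (`KerrRegionIINullIncompleteness.lean`).

## References

* B. Carter, *Global structure of the Kerr family of gravitational fields*, Phys. Rev. 174 (1968)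
  1559–1571, §IV; Comm. Math. Phys. 10 (1968) 280–310, §4. Key `Carter1968`.
* B. O'Neill, *The geometry of Kerr black holes*, A K Peters 1995, Ch. 4, §4.2, Thm. 4.2.2,
  Cor. 4.2.7 (`𝒦 ≥ 0`; the `r`- and `θ`-equations). Key `ONeill1995`.
-/

noncomputable section

set_option maxSynthPendingDepth 3

open Set Function Module Real
open scoped Topology ContDiff
open Literature.Geometry.Lorentzian.MetricCoord

namespace Literature.Geometry.Lorentzian

namespace Kerr

/-! ### The two sign facts in the ingoing chart -/

namespace Ingoing

variable {M a r₀ : ℝ} {u : E4}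

/-- **Carter's `𝒦` in the chart**: `𝒬 + (L − aE)² = Σ²(w^μ)²/(1 − μ²) + (L − a(1 − μ²)E)²/(1 − μ²)`
(`μ² ≠ 1`): the polar momentum term plus the `𝔻²/sin²θ` term (O'Neill 1995, Ch. 4, §4.2).
[cite: ONeill1995, Ch. 4, §4.2] -/
theorem carterQ_add_sq (hP : sinSq u ≠ 0) (w : E4) :
    carterQ M a u w + (angMom M a u w - a * energy M a u w) ^ 2 =
      sigma a u ^ 2 * w 2 ^ 2 / sinSq u +
        (angMom M a u w - a * sinSq u * energy M a u w) ^ 2 / sinSq u := by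
  unfold carterQ
  simp only [sinSq] at hP ⊢
  field_simp
  ring

/-- **The radial sign fact in the chart**: on the coordinate domain, for every vector `w`,
`(Σ²(wʳ)² − ΣΔ g(w,w) − ℙ²) · Δ = −Δ² 𝒦(w) ≤ 0`. [cite: ONeill1995, Ch. 4, Thm. 4.2.2] -/
theorem radial_core (hu : u ∈ coordDomain r₀) (w : E4) :
    (sigma a u ^ 2 * w 1 ^ 2 - sigma a u * (u 1 ^ 2 - 2 * M * u 1 + a ^ 2) * bilin M a u w w -
        (energy M a u w * (u 1 ^ 2 + a ^ 2) - a * angMom M a u w) ^ 2) *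
      (u 1 ^ 2 - 2 * M * u 1 + a ^ 2) ≤ 0 := by
  have hreg : u ∈ regularSet a := mem_regularSet_of_mem_coordDomain hu
  have hPpos : 0 < sinSq u := sinSq_pos hu
  have h := sq_sigma_mul_sq_sub_nullRadialPotential (M := M) hreg w
  have hK := carterQ_add_sq (M := M) (a := a) hreg.2 w
  have hKnn : 0 ≤ carterQ M a u w + (angMom M a u w - a * energy M a u w) ^ 2 := by
    rw [hK]; positivity
  unfold nullRadialPotential at h
  have hX : (sigma a u ^ 2 * w 1 ^ 2 - sigma a u * (u 1 ^ 2 - 2 * M * u 1 + a ^ 2) * bilin M a u w w -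
        (energy M a u w * (u 1 ^ 2 + a ^ 2) - a * angMom M a u w) ^ 2) *
      (u 1 ^ 2 - 2 * M * u 1 + a ^ 2) =
      -((u 1 ^ 2 - 2 * M * u 1 + a ^ 2) ^ 2 *
        (carterQ M a u w + (angMom M a u w - a * energy M a u w) ^ 2)) := by
    linear_combination (u 1 ^ 2 - 2 * M * u 1 + a ^ 2) * h
  rw [hX]
  exact neg_nonpos.2 (mul_nonneg (sq_nonneg _) hKnn)

/-- **The polar sign fact in the chart**: on the coordinate domain, for every vector `w`,
`(s²(Σ²(wʳ)² − ΣΔ g(w,w) − ℙ²) + Δ(L − a s² E)²) · Δ = −Δ² Σ² (w^μ)² ≤ 0`, `s² = 1 − μ²`.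
[cite: ONeill1995, Ch. 4, Thm. 4.2.2] -/
theorem polar_core (hu : u ∈ coordDomain r₀) (w : E4) :
    (sinSq u * (sigma a u ^ 2 * w 1 ^ 2 -
          sigma a u * (u 1 ^ 2 - 2 * M * u 1 + a ^ 2) * bilin M a u w w -
          (energy M a u w * (u 1 ^ 2 + a ^ 2) - a * angMom M a u w) ^ 2) +
        (u 1 ^ 2 - 2 * M * u 1 + a ^ 2) * (angMom M a u w - a * sinSq u * energy M a u w) ^ 2) *
      (u 1 ^ 2 - 2 * M * u 1 + a ^ 2) ≤ 0 := by
  have hreg : u ∈ regularSet a := mem_regularSet_of_mem_coordDomain hu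
  have hP : sinSq u ≠ 0 := hreg.2
  have h := sq_sigma_mul_sq_sub_nullRadialPotential (M := M) hreg w
  have hK := carterQ_add_sq (M := M) (a := a) hP w
  unfold nullRadialPotential at h
  -- the bracket is `−Δ Σ² (w²)²`
  have key : sinSq u * (sigma a u ^ 2 * w 1 ^ 2 -
        sigma a u * (u 1 ^ 2 - 2 * M * u 1 + a ^ 2) * bilin M a u w w -
        (energy M a u w * (u 1 ^ 2 + a ^ 2) - a * angMom M a u w) ^ 2) +
      (u 1 ^ 2 - 2 * M * u 1 + a ^ 2) * (angMom M a u w - a * sinSq u * energy M a u w) ^ 2 =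
      -((u 1 ^ 2 - 2 * M * u 1 + a ^ 2) * sigma a u ^ 2 * w 2 ^ 2) := by
    have h' : sinSq u * (carterQ M a u w + (angMom M a u w - a * energy M a u w) ^ 2) =
        sigma a u ^ 2 * w 2 ^ 2 + (angMom M a u w - a * sinSq u * energy M a u w) ^ 2 := by
      rw [hK]
      field_simp
    linear_combination sinSq u * h - (u 1 ^ 2 - 2 * M * u 1 + a ^ 2) * h'
  rw [key]
  nlinarith [sq_nonneg ((u 1 ^ 2 - 2 * M * u 1 + a ^ 2) * sigma a u * w 2)]

/-- `1 − (x₃/r)² = 1 − μ²` at the image point. [cite: arXiv07060622, §4] -/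
theorem one_sub_sq_apply_three_div_radius (hu : u ∈ coordDomain r₀) :
    1 - (chartFun a r₀ u 3 / radius a (chartFun a r₀ u)) ^ 2 = sinSq u := by
  rw [chartFun_apply_three a hu, radius_chartFun_of_mem a hu, sinSq,
    mul_div_cancel_left₀ _ (radial_pos hu).ne']

end Ingoing

/-! ### Density: inequalities pass to the axis -/

/-- **Density principle for inequalities** on the chart domain: a continuous function that is
`≤ 0` off the rotation axis is `≤ 0` everywhere (`max G 0` is continuous and vanishes off the axis;
`Kerr.eqOn_region_of_offAxis`). [folklore] -/
theorem nonpos_region_of_offAxis {a r₀ : ℝ} {G : E4 → ℝ} (hG : ContinuousOn G (region a r₀))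
    (h : ∀ y ∈ region a r₀, (y 1 ≠ 0 ∨ y 2 ≠ 0) → G y ≤ 0) :
    ∀ y ∈ region a r₀, G y ≤ 0 := fun y hy ↦
  (le_max_left _ _).trans_eq (eqOn_region_of_offAxis
    (ContinuousOn.sup hG continuousOn_const : ContinuousOn (fun y ↦ max (G y) 0) (region a r₀))
    (fun z hz hax ↦ max_eq_right (h z hz hax)) y hy)

/-! ### Carter's constant of a vector in Kerr–Schild coordinates -/

/-- **Carter's constant read from Kerr–Schild data**, for a vector `w` at a point `z` off the
horizons: `𝒦 = (ℙ² − Σ²ρ²)/Δ` with `ℙ = E(r² + a²) − aL` (`E = Kerr.ksEnergy`, `L = Kerr.ksAngMom`),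
`ρ = dr_z(w)`, `Σ = Kerr.blSigma a z⃗`, `Δ(r) = r² − 2Mr + a²`. For a NULL `w` this is Carter's
`𝒦 = 𝒬 + (L − aE)²` of the null geodesic with velocity `w` (the separated radial equation
`Σ² ṙ² = ℙ² − Δ𝒦`, O'Neill 1995, Ch. 4, Thm. 4.2.2); it is conserved along null geodesics
(`KerrCarterConstant.lean`). Junk value where `Δ = 0` (division by zero). [cite: ONeill1995, Ch. 4, Thm. 4.2.2] -/
def ksCarterK (M a : ℝ) (z w : E4) : ℝ :=
  ((ksEnergy M a z w * (radius a z ^ 2 + a ^ 2) - a * ksAngMom M a z w) ^ 2 -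
      blSigma a (E4.spatial z) ^ 2 * fderiv ℝ (radius a) z w ^ 2) /
    (radius a z ^ 2 - 2 * M * radius a z + a ^ 2)

variable {M a : ℝ}

/-- **Carter's radial inequality in Kerr–Schild coordinates**, at every point with `r > 0` (axis
included) and for every vector `w`: `(Σ²ρ² − ΣΔ g(w, w) − ℙ²) · Δ ≤ 0`.
[cite: ONeill1995, Ch. 4, Thm. 4.2.2] -/
theorem radial_inequality {z : E4} (hz : 0 < radius a z) (w : E4) :
    (blSigma a (E4.spatial z) ^ 2 * fderiv ℝ (radius a) z w ^ 2 -
        blSigma a (E4.spatial z) * (radius a z ^ 2 - 2 * M * radius a z + a ^ 2) * Kerr.bilin M a z w w -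
        (ksEnergy M a z w * (radius a z ^ 2 + a ^ 2) - a * ksAngMom M a z w) ^ 2) *
      (radius a z ^ 2 - 2 * M * radius a z + a ^ 2) ≤ 0 := by
  have hr : ContinuousOn (radius a) (region a 0 : Set E4) := (continuous_radius a).continuousOn
  have hS := continuousOn_blSigma_spatial a 0
  have hE := continuousOn_ksEnergy M a 0 w
  have hL := continuousOn_ksAngMom M a 0 w
  have hg := continuousOn_bilin_apply M a 0 w w
  have hρ := continuousOn_fderiv_radius_apply a 0 w
  have hΔ : ContinuousOn (fun z : E4 ↦ radius a z ^ 2 - 2 * M * radius a z + a ^ 2) (region a 0) :=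
    ((hr.pow 2).sub (continuousOn_const.mul hr)).add continuousOn_const
  have hP : ContinuousOn (fun z : E4 ↦ ksEnergy M a z w * (radius a z ^ 2 + a ^ 2) -
      a * ksAngMom M a z w) (region a 0) :=
    (hE.mul ((hr.pow 2).add continuousOn_const)).sub (continuousOn_const.mul hL)
  have hcont : ContinuousOn (fun z : E4 ↦
      (blSigma a (E4.spatial z) ^ 2 * fderiv ℝ (radius a) z w ^ 2 -
        blSigma a (E4.spatial z) * (radius a z ^ 2 - 2 * M * radius a z + a ^ 2) * Kerr.bilin M a z w w -
        (ksEnergy M a z w * (radius a z ^ 2 + a ^ 2) - a * ksAngMom M a z w) ^ 2) *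
      (radius a z ^ 2 - 2 * M * radius a z + a ^ 2)) (region a 0) :=
    ((((hS.pow 2).mul (hρ.pow 2)).sub ((hS.mul hΔ).mul hg)).sub (hP.pow 2)).mul hΔ
  have hz' : z ∈ region a 0 := by rw [mem_region, max_self]; exact hz
  refine nonpos_region_of_offAxis hcont (fun y hy hax ↦ ?_) z hz'
  obtain ⟨u, hu, rfl⟩ := Ingoing.exists_chartFun_eq (a := a) (r₀ := 0) hy hax
  obtain ⟨v, rfl⟩ := Ingoing.jac_surjective (a := a) hu w
  rw [Ingoing.ksEnergy_chartFun_jac hu, Ingoing.ksAngMom_chartFun_jac hu, Ingoing.kerrBilin_jac hu,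
    Ingoing.fderiv_radius_chartFun_jac hu, Ingoing.blSigma_spatial_chartFun hu,
    Ingoing.radius_chartFun_of_mem a hu]
  exact Ingoing.radial_core hu v

/-- **Carter's polar inequality in Kerr–Schild coordinates**, at every point with `r > 0` (axis
included) and for every vector `w`, `s² = 1 − (z₃/r)²`:
`(s²(Σ²ρ² − ΣΔ g(w, w) − ℙ²) + Δ(L − a s² E)²) · Δ ≤ 0`. [cite: ONeill1995, Ch. 4, Thm. 4.2.2] -/
theorem polar_inequality {z : E4} (hz : 0 < radius a z) (w : E4) :
    ((1 - (z 3 / radius a z) ^ 2) *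
          (blSigma a (E4.spatial z) ^ 2 * fderiv ℝ (radius a) z w ^ 2 -
            blSigma a (E4.spatial z) * (radius a z ^ 2 - 2 * M * radius a z + a ^ 2) *
              Kerr.bilin M a z w w -
            (ksEnergy M a z w * (radius a z ^ 2 + a ^ 2) - a * ksAngMom M a z w) ^ 2) +
        (radius a z ^ 2 - 2 * M * radius a z + a ^ 2) *
          (ksAngMom M a z w - a * (1 - (z 3 / radius a z) ^ 2) * ksEnergy M a z w) ^ 2) *
      (radius a z ^ 2 - 2 * M * radius a z + a ^ 2) ≤ 0 := by
  have hr : ContinuousOn (radius a) (region a 0 : Set E4) := (continuous_radius a).continuousOn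
  have hr0 : ∀ y ∈ (region a 0 : Set E4), radius a y ≠ 0 := fun y hy ↦ (radius_pos_of_mem_region hy).ne'
  have hS := continuousOn_blSigma_spatial a 0
  have hE := continuousOn_ksEnergy M a 0 w
  have hL := continuousOn_ksAngMom M a 0 w
  have hg := continuousOn_bilin_apply M a 0 w w
  have hρ := continuousOn_fderiv_radius_apply a 0 w
  have hΔ : ContinuousOn (fun z : E4 ↦ radius a z ^ 2 - 2 * M * radius a z + a ^ 2) (region a 0) :=
    ((hr.pow 2).sub (continuousOn_const.mul hr)).add continuousOn_const
  have hP : ContinuousOn (fun z : E4 ↦ ksEnergy M a z w * (radius a z ^ 2 + a ^ 2) -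
      a * ksAngMom M a z w) (region a 0) :=
    (hE.mul ((hr.pow 2).add continuousOn_const)).sub (continuousOn_const.mul hL)
  have h3 : ContinuousOn (fun z : E4 ↦ z 3) (region a 0) :=
    (EuclideanSpace.proj (𝕜 := ℝ) (3 : Fin 4)).continuous.continuousOn
  have hs : ContinuousOn (fun z : E4 ↦ 1 - (z 3 / radius a z) ^ 2) (region a 0) :=
    continuousOn_const.sub ((h3.div hr hr0).pow 2)
  have hcont : ContinuousOn (fun z : E4 ↦
      ((1 - (z 3 / radius a z) ^ 2) *
          (blSigma a (E4.spatial z) ^ 2 * fderiv ℝ (radius a) z w ^ 2 -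
            blSigma a (E4.spatial z) * (radius a z ^ 2 - 2 * M * radius a z + a ^ 2) *
              Kerr.bilin M a z w w -
            (ksEnergy M a z w * (radius a z ^ 2 + a ^ 2) - a * ksAngMom M a z w) ^ 2) +
        (radius a z ^ 2 - 2 * M * radius a z + a ^ 2) *
          (ksAngMom M a z w - a * (1 - (z 3 / radius a z) ^ 2) * ksEnergy M a z w) ^ 2) *
      (radius a z ^ 2 - 2 * M * radius a z + a ^ 2)) (region a 0) :=
    ((hs.mul ((((hS.pow 2).mul (hρ.pow 2)).sub ((hS.mul hΔ).mul hg)).sub (hP.pow 2))).add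
      (hΔ.mul ((hL.sub ((continuousOn_const.mul hs).mul hE)).pow 2))).mul hΔ
  have hz' : z ∈ region a 0 := by rw [mem_region, max_self]; exact hz
  refine nonpos_region_of_offAxis hcont (fun y hy hax ↦ ?_) z hz'
  obtain ⟨u, hu, rfl⟩ := Ingoing.exists_chartFun_eq (a := a) (r₀ := 0) hy hax
  obtain ⟨v, rfl⟩ := Ingoing.jac_surjective (a := a) hu w
  rw [Ingoing.one_sub_sq_apply_three_div_radius hu, Ingoing.ksEnergy_chartFun_jac hu,
    Ingoing.ksAngMom_chartFun_jac hu, Ingoing.kerrBilin_jac hu, Ingoing.fderiv_radius_chartFun_jac hu,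
    Ingoing.blSigma_spatial_chartFun hu, Ingoing.radius_chartFun_of_mem a hu]
  exact Ingoing.polar_core hu v

/-- **Carter's constant of a null vector is non-negative**: at a point with `r > 0` off the
horizons (`Δ ≠ 0`), a null vector `w` has `𝒦 = (ℙ² − Σ²ρ²)/Δ ≥ 0` (O'Neill 1995, Ch. 4,
Cor. 4.2.7: `𝒦 ≥ 0` on null geodesics). [cite: ONeill1995, Ch. 4, Cor. 4.2.7] -/
theorem ksCarterK_nonneg {z : E4} (hz : 0 < radius a z)
    (hΔ : radius a z ^ 2 - 2 * M * radius a z + a ^ 2 ≠ 0) {w : E4} (hw : Kerr.bilin M a z w w = 0) :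
    0 ≤ ksCarterK M a z w := by
  have h := radial_inequality (M := M) hz w
  rw [hw, mul_zero, sub_zero] at h
  unfold ksCarterK
  set Δ := radius a z ^ 2 - 2 * M * radius a z + a ^ 2 with hΔdef
  set X := (ksEnergy M a z w * (radius a z ^ 2 + a ^ 2) - a * ksAngMom M a z w) ^ 2 -
    blSigma a (E4.spatial z) ^ 2 * fderiv ℝ (radius a) z w ^ 2 with hX
  have hXΔ : 0 ≤ X * Δ := by nlinarith [h]
  have hre : X / Δ = X * Δ / Δ ^ 2 := by field_simp
  rw [hre]
  exact div_nonneg hXΔ (sq_nonneg Δ)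

/-- **The polar bound on Carter's constant**: at a point with `r > 0` off the horizons, a null
vector `w` has `(L − a s² E)² ≤ s² 𝒦`, `s² = 1 − (z₃/r)² = sin²θ` — the non-negativity of the
`θ`-momentum term `Σ²θ̇² = 𝒦 − (L − aE sin²θ)²/sin²θ` (O'Neill 1995, Ch. 4, Thm. 4.2.2); in
particular `𝒦 = 0` forces `L = a sin²θ E`. [cite: ONeill1995, Ch. 4, Thm. 4.2.2] -/
theorem sq_sub_le_sinSq_mul_ksCarterK {z : E4} (hz : 0 < radius a z)
    (hΔ : radius a z ^ 2 - 2 * M * radius a z + a ^ 2 ≠ 0) {w : E4} (hw : Kerr.bilin M a z w w = 0) :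
    (ksAngMom M a z w - a * (1 - (z 3 / radius a z) ^ 2) * ksEnergy M a z w) ^ 2 ≤
      (1 - (z 3 / radius a z) ^ 2) * ksCarterK M a z w := by
  have h := polar_inequality (M := M) hz w
  rw [hw, mul_zero, sub_zero] at h
  unfold ksCarterK
  set Δ := radius a z ^ 2 - 2 * M * radius a z + a ^ 2 with hΔdef
  set X := (ksEnergy M a z w * (radius a z ^ 2 + a ^ 2) - a * ksAngMom M a z w) ^ 2 -
    blSigma a (E4.spatial z) ^ 2 * fderiv ℝ (radius a) z w ^ 2 with hX
  set s2 := 1 - (z 3 / radius a z) ^ 2 with hs2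
  set D := ksAngMom M a z w - a * s2 * ksEnergy M a z w with hD
  have hΔ2 : 0 < Δ ^ 2 := by positivity
  have key : Δ ^ 2 * D ^ 2 ≤ s2 * (X * Δ) := by nlinarith [h]
  have hre : s2 * (X / Δ) = s2 * (X * Δ) / Δ ^ 2 := by field_simp
  rw [hre, le_div_iff₀ hΔ2]
  linarith [key]

end Kerr

end Literature.Geometry.Lorentzian

end
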